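import Summits.ResolutionOfSingularities.ResolutionOfSingularities.Theorems.FrobeniusClosingSteerConeBinary
import HarnessLib

/-!
# Crux `Steer` (stmt-ResolutionOfSingularities-16345), chain W4.1, F-B-wild fork (Par-S), ARITH-REDUCTION: **the cone lemmas (R2)/(R4)
# of the binary residue in FOUR variables** (res-L0-w41-idea-1 card-7 addendum g8 §F (R2)/(R4); tri-1 TRIAGE v6.10 (2); pv-007's `Cone`
# currency `…SteerConeBinary` lifted from the plane to `ℙ³`)

OURS (campaign `res-hironaka`, rung L ★L-G4, slot W4.1; seat res-type-096 g9 on res-L0-w41-plan-1 RULING 115a «096 #1»; replaces the role of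
no printed item; NOT a statement of the manuscript under review [claim: Hironaka2017, status: under-review]; AI-produced, weaker than expert review).
Theses-free and definition-free (the substitutions are written out with `MvPolynomial.aeval`; variables `X 0 = U`, `X 1 = Y`, `X 2 = Z`,
`X 3 = W` of `MvPolynomial (Fin 4) κ`).

* `cone_fourVar_of_mult_eq_deg` — **(R2) in four variables, one vertex**: a quaternary form `Θ(U,Y,Z,W)` of degree `d` which is a CONE over
  the rational direction `[0 : 1 : a : b]` — its dehomogenisation `Θ(U, 1, Z, W)` in the chart `Y = 1` has order `≥ d` at the point
  `(0, a, b)` — lies in the subalgebra of the three linear forms vanishing there: `Θ = Ξ(U, Z − aY, W − bY)` with `Ξ` a ternary form of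
  degree `d` (namely `Ξ = Θ(U, 1, Z + a, W + b)`: degree `≤ d` and order `≥ d`, hence a form; the identity because both sides are forms of
  degree `d` with the same dehomogenisation `Y ↦ 1`, pv-007's route via `DescentSpace.eq_of_isHomogeneous_of_aeval_dehom_eq`).
* `binary_restrict_of_cone_fourVar` — **hence the restriction to the hyperplane `U = 0` is BINARY**: `Θ(0, Y, Z, W) = Ψ(Z − aY, W − bY)` with
  `Ψ = Ξ(0, ·, ·)` a binary form of degree `d`.
* `binary_of_restrict_eq_of_cone_fourVar` — **(R4) the even-satellite law**: if `Φ_{A′} = Θ` restricts to `Φ_A(Y, Z, W)` modulo `U`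
  (`Θ(0,Y,Z,W) = Φ_A`) and `Θ` is a cone over an even-satellite direction `δ = [0 : 1 : a : b]` (`δ_U = 0`), then `Φ_A = Ψ(Z − aY, W − bY)`
  is BINARY.

[folklore]
-/

noncomputable section

-- `Summit.<S>.<S>.…` duplicates the summit name by design (single-problem summit).
set_option linter.dupNamespace false

open MvPolynomial

namespace Summit.ResolutionOfSingularities.ResolutionOfSingularities.Theorems.SwitchingDichotomy

namespace BinaryResidue

universe u

variable (κ : Type u) [Field κ]

/-- The monomials of a polynomial in three variables have degree `m 0 + m 1 + m 2`. [folklore] -/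
theorem sum_eq_add_fin_three (m : Fin 3 →₀ ℕ) : (m.sum fun _ e => e) = m 0 + m 1 + m 2 := by
  rw [Finsupp.sum_fintype _ _ (fun _ => rfl), Fin.sum_univ_three]

/-- The dehomogenisation `Y ↦ 1` of a quaternary polynomial, re-embedded into four variables, is `aeval` of the generic dehomogenising
substitution at the index `1`. [folklore] -/
theorem rename_dehomY (Θ : MvPolynomial (Fin 4) κ) :
    rename (![0, 2, 3] : Fin 3 → Fin 4)
        (aeval (![X 0, 1, X 1, X 2] : Fin 4 → MvPolynomial (Fin 3) κ) Θ) =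
      aeval (fun i => if i = (1 : Fin 4) then (1 : MvPolynomial (Fin 4) κ) else X i) Θ := by
  rw [← AlgHom.comp_apply]
  congr 1
  refine MvPolynomial.algHom_ext fun i => ?_
  rw [AlgHom.comp_apply, aeval_X, aeval_X]
  fin_cases i <;> simp

/-- **(R2) IN FOUR VARIABLES — a cone over a rational direction lies in the subalgebra of the linear forms vanishing there.** Let `Θ` be
a quaternary form of degree `d` (variables `U, Y, Z, W = X 0, X 1, X 2, X 3`) whose hypersurface has multiplicity `d` at the rational
point `[0 : 1 : a : b]`: every monomial of `Θ(U, 1, Z + a, W + b)` has degree `≥ d`. Then `Θ = Ξ(U, Z − aY, W − bY)` for a ternary form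
`Ξ` of degree `d`. OURS. [folklore] -/
theorem cone_fourVar_of_mult_eq_deg (d : ℕ) (Θ : MvPolynomial (Fin 4) κ) (hΘ : Θ.IsHomogeneous d) (a b : κ)
    (hmult : ∀ m ∈ (aeval (![X 0, X 1 + C a, X 2 + C b] : Fin 3 → MvPolynomial (Fin 3) κ)
        (aeval (![X 0, 1, X 1, X 2] : Fin 4 → MvPolynomial (Fin 3) κ) Θ)).support, d ≤ m 0 + m 1 + m 2) :
    ∃ Ξ : MvPolynomial (Fin 3) κ, Ξ.IsHomogeneous d ∧
      Θ = aeval (![X 0, X 2 - C a * X 1, X 3 - C b * X 1] : Fin 3 → MvPolynomial (Fin 4) κ) Ξ := by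
  -- `Ξ := Θ(U, 1, Z + a, W + b)` is a ternary form of degree `d`
  set Ξ := aeval (![X 0, X 1 + C a, X 2 + C b] : Fin 3 → MvPolynomial (Fin 3) κ)
    (aeval (![X 0, 1, X 1, X 2] : Fin 4 → MvPolynomial (Fin 3) κ) Θ) with hΞdef
  have hdeg : Ξ.totalDegree ≤ d := by
    refine (Cone.totalDegree_aeval_le_of_forall _ (fun i => ?_) _).trans
      ((Cone.totalDegree_aeval_le_of_forall _ (fun i => ?_) _).trans hΘ.totalDegree_le)
    · fin_cases i
      · exact (totalDegree_X _).le
      · exact (totalDegree_add _ _).trans (max_le (totalDegree_X _).le (by rw [totalDegree_C]; exact zero_le_one))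
      · exact (totalDegree_add _ _).trans (max_le (totalDegree_X _).le (by rw [totalDegree_C]; exact zero_le_one))
    · fin_cases i
      · exact (totalDegree_X _).le
      · exact (totalDegree_one (R := κ) (σ := Fin 3)).le.trans zero_le_one
      · exact (totalDegree_X _).le
      · exact (totalDegree_X _).le
  have hΞ : Ξ.IsHomogeneous d :=
    Cone.isHomogeneous_of_totalDegree_le_of_forall _ d hdeg fun m hm => by
      rw [sum_eq_add_fin_three]; exact hmult m hm
  refine ⟨Ξ, hΞ, ?_⟩
  -- both sides are quaternary forms of degree `d` …
  have hlin : ∀ i : Fin 3,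
      ((![X 0, X 2 - C a * X 1, X 3 - C b * X 1] : Fin 3 → MvPolynomial (Fin 4) κ) i).IsHomogeneous 1 := by
    intro i
    fin_cases i
    · exact isHomogeneous_X κ 0
    · exact (isHomogeneous_X κ 2).sub ((isHomogeneous_X κ 1).C_mul a)
    · exact (isHomogeneous_X κ 3).sub ((isHomogeneous_X κ 1).C_mul b)
  refine DescentSpace.eq_of_isHomogeneous_of_aeval_dehom_eq (1 : Fin 4) hΘ
    (Cone.isHomogeneous_aeval_of_forall _ hlin hΞ) ?_
  -- … with the same dehomogenisation `Y ↦ 1`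
  have hcomp : ((aeval fun i => if i = (1 : Fin 4) then (1 : MvPolynomial (Fin 4) κ) else X i).comp
      ((aeval (![X 0, X 2 - C a * X 1, X 3 - C b * X 1] : Fin 3 → MvPolynomial (Fin 4) κ)).comp
        ((aeval (![X 0, X 1 + C a, X 2 + C b] : Fin 3 → MvPolynomial (Fin 3) κ)).comp
          (aeval (![X 0, 1, X 1, X 2] : Fin 4 → MvPolynomial (Fin 3) κ))))) =
      (rename (![0, 2, 3] : Fin 3 → Fin 4)).comp
        (aeval (![X 0, 1, X 1, X 2] : Fin 4 → MvPolynomial (Fin 3) κ)) := by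
    refine MvPolynomial.algHom_ext fun i => ?_
    fin_cases i <;> simp
  have happ := congrArg (fun f => f Θ) hcomp
  simp only [AlgHom.comp_apply] at happ
  rw [← rename_dehomY, hΞdef]
  exact happ.symm

/-- **The restriction of a cone over `[0 : 1 : a : b]` to the hyperplane `U = 0` is a BINARY form in `Z − aY, W − bY`** (idea-1 (R2):
`Θ|_{U=0} = Ψ(Z − aY, W − bY)`). Here `Θ(0, Y, Z, W)` is written in the ternary ring with `Y, Z, W = X 0, X 1, X 2`, as in pv-007's
`Cone.binary_of_mult_eq_deg`. OURS. [folklore] -/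
theorem binary_restrict_of_cone_fourVar (d : ℕ) (Θ : MvPolynomial (Fin 4) κ) (hΘ : Θ.IsHomogeneous d) (a b : κ)
    (hmult : ∀ m ∈ (aeval (![X 0, X 1 + C a, X 2 + C b] : Fin 3 → MvPolynomial (Fin 3) κ)
        (aeval (![X 0, 1, X 1, X 2] : Fin 4 → MvPolynomial (Fin 3) κ) Θ)).support, d ≤ m 0 + m 1 + m 2) :
    ∃ Ψ : MvPolynomial (Fin 2) κ, Ψ.IsHomogeneous d ∧
      aeval (![0, X 0, X 1, X 2] : Fin 4 → MvPolynomial (Fin 3) κ) Θ =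
        aeval (![X 1 - C a * X 0, X 2 - C b * X 0] : Fin 2 → MvPolynomial (Fin 3) κ) Ψ := by
  obtain ⟨Ξ, hΞ, hΘΞ⟩ := cone_fourVar_of_mult_eq_deg κ d Θ hΘ a b hmult
  -- `Ψ := Ξ(0, ·, ·)`
  refine ⟨aeval (![0, X 0, X 1] : Fin 3 → MvPolynomial (Fin 2) κ) Ξ,
    Cone.isHomogeneous_aeval_of_forall _ (fun i => ?_) hΞ, ?_⟩
  · fin_cases i
    · exact isHomogeneous_zero _ _ _
    · exact isHomogeneous_X κ 0
    · exact isHomogeneous_X κ 1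
  · have hcomp : ((aeval (![0, X 0, X 1, X 2] : Fin 4 → MvPolynomial (Fin 3) κ)).comp
        (aeval (![X 0, X 2 - C a * X 1, X 3 - C b * X 1] : Fin 3 → MvPolynomial (Fin 4) κ))) =
        ((aeval (![X 1 - C a * X 0, X 2 - C b * X 0] : Fin 2 → MvPolynomial (Fin 3) κ)).comp
          (aeval (![0, X 0, X 1] : Fin 3 → MvPolynomial (Fin 2) κ))) := by
      refine MvPolynomial.algHom_ext fun i => ?_
      fin_cases i <;> simp
    have happ := congrArg (fun f => f Ξ) hcomp
    simp only [AlgHom.comp_apply] at happ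
    rw [hΘΞ]
    exact happ

/-- **(R4) THE EVEN-SATELLITE LAW** (idea-1 card-7 addendum g8 §F (R4), tri-1 v6.10 (2)): if the next A-cone `Θ = Φ_{A′}(U,Y,Z,W)`
(a form of degree `d`) reduces to the previous cone modulo `U`, `Θ(0, Y, Z, W) = Φ_A(Y, Z, W)`, and `Θ` is a cone over an EVEN-SATELLITE
direction `δ = [0 : 1 : a : b]` (`δ_U = 0`), then the previous cone is BINARY: `Φ_A = Ψ(Z − aY, W − bY)`. OURS. [folklore] -/
theorem binary_of_restrict_eq_of_cone_fourVar (d : ℕ) (Θ : MvPolynomial (Fin 4) κ) (hΘ : Θ.IsHomogeneous d) (a b : κ)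
    (hmult : ∀ m ∈ (aeval (![X 0, X 1 + C a, X 2 + C b] : Fin 3 → MvPolynomial (Fin 3) κ)
        (aeval (![X 0, 1, X 1, X 2] : Fin 4 → MvPolynomial (Fin 3) κ) Θ)).support, d ≤ m 0 + m 1 + m 2)
    (Φ : MvPolynomial (Fin 3) κ) (hres : aeval (![0, X 0, X 1, X 2] : Fin 4 → MvPolynomial (Fin 3) κ) Θ = Φ) :
    ∃ Ψ : MvPolynomial (Fin 2) κ, Ψ.IsHomogeneous d ∧
      Φ = aeval (![X 1 - C a * X 0, X 2 - C b * X 0] : Fin 2 → MvPolynomial (Fin 3) κ) Ψ := by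
  obtain ⟨Ψ, hΨ, h⟩ := binary_restrict_of_cone_fourVar κ d Θ hΘ a b hmult
  exact ⟨Ψ, hΨ, hres ▸ h⟩

end BinaryResidue

end Summit.ResolutionOfSingularities.ResolutionOfSingularities.Theorems.SwitchingDichotomy

end
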